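/-
Copyright: the b2b-balaban T⁴-continuum CRUX team, row NE7b OWNER lineage `t4-ne7b-p1` (gen 141). Project licence.
-/
import Summits.QuantumFields.BalabanUV.T4Continuum.Spine.NE7b.SupFourthCumulantPairCuts

/-!
# THE FOURTH CUMULANT ACROSS THE FOUR SINGLE CUTS (SCOPING (d13)(2), eighth file, continued).  As (492), for the cuts `{i}|{rest}`: with `f_i`
# centred at its true mean, `E[f₁f₂f₃f₄]` IS the cut covariance, bounded by (491)'s single-cut bound `(3K + 4M₄ + 4M₆)∕r_min⁶`, and the three
# subtracted pairings each contain a pair crossing the cut (`≤ K²∕r_min⁶`), so `|u₄| ≤ C·(max_{crossing} q)³` with the same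
# `C = 4K + 3K² + 4M₄ + 4M₆ + 2M₂(M₂+M₄)` — the remaining four of (487)'s seven hypotheses (row NE7b, node U5c; (491), (492), (487) BY NAME;
# [folklore])

Cell `pub-balaban`, sub-cell `t4`, spine estimate NE7b (`T4WeightBudget.RelWeightBound`; the cell's OWN estimate — NOT PRINTED in
[Bałaban 1983–89], NOT PROVED).  Crux-route work under `Spine/NE7b/` by the row OWNER (`t4-ne7b-p1` gen 141, file (495)) under FREEZE
(0)'s crux-prover clause; NOTHING of Bałaban's is named as a Lean object, valued or asserted; no `T4Continuum/Support` leaf typed; no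
`def`, no notation (`u₄` WRITTEN OUT); zero `sorry`.  Imports (BY NAME): the OWNER's (492) `…SupFourthCumulantPairCuts` (bookkeeping; through it (491), (487)).

WHAT IS PROVED ([folklore]): **`cut_three`**, **`cut_four`**.

HONEST (what this is NOT).  The abstract Gibbs-format statement; the whitened instantiation (`F_v = U′(Aξ+ψ)[e_v]`, `B ≤ K∕r²⁴` from (466) with
`r²⁴ ≤ σσ`, `M₂, M₄` from (464)∕(465)), the sixth-moment letter `M₆` (NOT discharged — (423)'s Gaussian moments to `|φ|¹²` needed), the site-indexed
row letter via (488), and the cumulant FORM of `∂⁴W` with its assembly are the successor's; scalar skeleton ((A3), NC-NE7b-α UNRULED); nothing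
of Bałaban's asserted.  BY-NAME EFFECT ON THE WALL: NONE.  NE7b NOT PRINTED ∕ NOT PROVED; spine PROVED 0∕9; rung (B)+1 — the programme's
measures remain FINITE-torus statements; NOT the mass gap, NOT Clay.  HONEST DEPENDENCY: continuum YM on T⁴ ⇐ BetaPertH ∧ nine spine
estimates (0∕9 proved); BetaPertH ⇐ (D1) ∧ (D4) ∧ CAP+tail; G-an2-4 gates asym, D1 and NE2∕3∕4.
-/

set_option autoImplicit false

noncomputable section

namespace Summit.QuantumFields.BalabanUV.T4Continuum.NE7b.SupFourthCumulantSingleCutsTwo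

open MeasureTheory Real Set Function Finset
open scoped BigOperators
open SupFourthCumulantCutBounds (single_cut_bound pairing_abs_le)
open SupFourPointCutTree (abs_u4_le_single_cut)
open SupFourthCumulantPairCuts (bilinear_symm pairing_prod_le pairing_prod_le' inv_min3_sq_le div_pow_six_le)

variable {ι : Type} [Fintype ι] [DecidableEq ι]

variable {V : (ι → ℝ) → ℝ} {V₁ : ι → (ι → ℝ) → ℝ} {c : ι → ℝ} {Cw γ : ℝ} {J D : ι → ι → ℝ}
  {P : ι → ((ι → ℝ) → ℝ) → ((ι → ℝ) → ℝ)} {F₁ F₂ F₃ F₄ : (ι → ℝ) → ℝ} {a₁ a₂ a₃ a₄ : ι → ℝ}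

/-- **CUT `{3}|{1,2,4}`**: `|u₄| ≤ C·max(q₁₃,q₂₃,q₃₄)³`. [folklore] -/
theorem cut_three (hP : ∀ x F ω, P x F ω = (∫ s, F (update ω x s) * exp (-V (update ω x s))) / ∫ s, exp (-V (update ω x s)))
    (hV : ∀ x ω, HasDerivAt (fun s => V (update ω x s)) (V₁ x ω) (ω x))
    (hfloor : ∀ x ω s t, c x * (s - t) ^ 2 ≤ (V₁ x (update ω x s) - V₁ x (update ω x t)) * (s - t)) (hc : ∀ x, 0 < c x)
    (hceil : ∀ x ω s t, |V₁ x (update ω x s) - V₁ x (update ω x t)| ≤ Cw * |s - t|)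
    (hcross : ∀ x z, z ≠ x → ∀ ω s t, |V₁ x (update ω z s) - V₁ x (update ω z t)| ≤ J x z * |s - t|) (hVc : Continuous V)
    (hV0 : Integrable (fun ω : ι → ℝ => exp (-V ω))) (hV2 : ∀ z, Integrable (fun ω : ι → ℝ => ω z ^ 2 * exp (-V ω)))
    (hJ : ∀ x z, 0 ≤ J x z) (hJ0 : ∀ x, J x x = 0) (hrow : ∀ x, ∑ z, J x z / c x ≤ γ) (hγ0 : 0 ≤ γ) (hγ1 : γ < 1)
    (hD : ∀ x y, 0 ≤ D x y) (hDC : ∀ x y, (if x = y then (1 : ℝ) else 0) + ∑ z, D x z * (J z y / c z) ≤ D x y)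
    (h1 : ∀ z ω s t, |F₁ (update ω z s) - F₁ (update ω z t)| ≤ a₁ z * |s - t|) (h2 : ∀ z ω s t, |F₂ (update ω z s) - F₂ (update ω z t)| ≤ a₂ z * |s -
        t|)
    (h3 : ∀ z ω s t, |F₃ (update ω z s) - F₃ (update ω z t)| ≤ a₃ z * |s - t|) (h4 : ∀ z ω s t, |F₄ (update ω z s) - F₄ (update ω z t)| ≤ a₄ z * |s -
        t|)
    {K r12 r13 r14 r23 r24 r34 M₂ M₄ M₆ : ℝ} (hK : 0 ≤ K) (hr12 : 1 ≤ r12) (hr13 : 1 ≤ r13) (hr14 : 1 ≤ r14) (hr23 : 1 ≤ r23) (hr24 : 1 ≤ r24) (hr34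
        : 1 ≤ r34)
    (hB12 : (∑ w, (∑ z, D z w * a₁ z) * (∑ z, D z w * a₂ z) / c w) ≤ K / r12 ^ 24)
    (hB13 : (∑ w, (∑ z, D z w * a₁ z) * (∑ z, D z w * a₃ z) / c w) ≤ K / r13 ^ 24)
    (hB14 : (∑ w, (∑ z, D z w * a₁ z) * (∑ z, D z w * a₄ z) / c w) ≤ K / r14 ^ 24)
    (hB23 : (∑ w, (∑ z, D z w * a₂ z) * (∑ z, D z w * a₃ z) / c w) ≤ K / r23 ^ 24)
    (hB24 : (∑ w, (∑ z, D z w * a₂ z) * (∑ z, D z w * a₄ z) / c w) ≤ K / r24 ^ 24)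
    (hB34 : (∑ w, (∑ z, D z w * a₃ z) * (∑ z, D z w * a₄ z) / c w) ≤ K / r34 ^ 24)
    (hq1 : Integrable (fun ω => (F₁ ω - (∫ ω', F₁ ω' ∂((volume : Measure (ι → ℝ)).tilted fun ω => -V ω))) ^ 4) ((volume : Measure (ι → ℝ)).tilted fun
        ω => -V ω)) (hs1 : Integrable (fun ω => (F₁ ω - (∫ ω', F₁ ω' ∂((volume : Measure (ι → ℝ)).tilted fun ω => -V ω))) ^ 6) ((volume : Measure (ι
        → ℝ)).tilted fun ω => -V ω))
    (hM21 : ∫ ω, (F₁ ω - (∫ ω', F₁ ω' ∂((volume : Measure (ι → ℝ)).tilted fun ω => -V ω))) ^ 2 ∂((volume : Measure (ι → ℝ)).tilted fun ω => -V ω) ≤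
        M₂) (hM41 : ∫ ω, (F₁ ω - (∫ ω', F₁ ω' ∂((volume : Measure (ι → ℝ)).tilted fun ω => -V ω))) ^ 4 ∂((volume : Measure (ι → ℝ)).tilted fun ω =>
        -V ω) ≤ M₄)
    (hM61 : ∫ ω, (F₁ ω - (∫ ω', F₁ ω' ∂((volume : Measure (ι → ℝ)).tilted fun ω => -V ω))) ^ 6 ∂((volume : Measure (ι → ℝ)).tilted fun ω => -V ω) ≤
        M₆)
    (hq2 : Integrable (fun ω => (F₂ ω - (∫ ω', F₂ ω' ∂((volume : Measure (ι → ℝ)).tilted fun ω => -V ω))) ^ 4) ((volume : Measure (ι → ℝ)).tilted fun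
        ω => -V ω)) (hs2 : Integrable (fun ω => (F₂ ω - (∫ ω', F₂ ω' ∂((volume : Measure (ι → ℝ)).tilted fun ω => -V ω))) ^ 6) ((volume : Measure (ι
        → ℝ)).tilted fun ω => -V ω))
    (_hM22 : ∫ ω, (F₂ ω - (∫ ω', F₂ ω' ∂((volume : Measure (ι → ℝ)).tilted fun ω => -V ω))) ^ 2 ∂((volume : Measure (ι → ℝ)).tilted fun ω => -V ω) ≤
        M₂) (hM42 : ∫ ω, (F₂ ω - (∫ ω', F₂ ω' ∂((volume : Measure (ι → ℝ)).tilted fun ω => -V ω))) ^ 4 ∂((volume : Measure (ι → ℝ)).tilted fun ω =>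
        -V ω) ≤ M₄)
    (hM62 : ∫ ω, (F₂ ω - (∫ ω', F₂ ω' ∂((volume : Measure (ι → ℝ)).tilted fun ω => -V ω))) ^ 6 ∂((volume : Measure (ι → ℝ)).tilted fun ω => -V ω) ≤
        M₆)
    (hq3 : Integrable (fun ω => (F₃ ω - (∫ ω', F₃ ω' ∂((volume : Measure (ι → ℝ)).tilted fun ω => -V ω))) ^ 4) ((volume : Measure (ι → ℝ)).tilted fun
        ω => -V ω)) (hs3 : Integrable (fun ω => (F₃ ω - (∫ ω', F₃ ω' ∂((volume : Measure (ι → ℝ)).tilted fun ω => -V ω))) ^ 6) ((volume : Measure (ι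
        → ℝ)).tilted fun ω => -V ω))
    (_hM23 : ∫ ω, (F₃ ω - (∫ ω', F₃ ω' ∂((volume : Measure (ι → ℝ)).tilted fun ω => -V ω))) ^ 2 ∂((volume : Measure (ι → ℝ)).tilted fun ω => -V ω) ≤
        M₂) (hM43 : ∫ ω, (F₃ ω - (∫ ω', F₃ ω' ∂((volume : Measure (ι → ℝ)).tilted fun ω => -V ω))) ^ 4 ∂((volume : Measure (ι → ℝ)).tilted fun ω =>
        -V ω) ≤ M₄)
    (hM63 : ∫ ω, (F₃ ω - (∫ ω', F₃ ω' ∂((volume : Measure (ι → ℝ)).tilted fun ω => -V ω))) ^ 6 ∂((volume : Measure (ι → ℝ)).tilted fun ω => -V ω) ≤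
        M₆)
    (hq4 : Integrable (fun ω => (F₄ ω - (∫ ω', F₄ ω' ∂((volume : Measure (ι → ℝ)).tilted fun ω => -V ω))) ^ 4) ((volume : Measure (ι → ℝ)).tilted fun
        ω => -V ω)) (hs4 : Integrable (fun ω => (F₄ ω - (∫ ω', F₄ ω' ∂((volume : Measure (ι → ℝ)).tilted fun ω => -V ω))) ^ 6) ((volume : Measure (ι
        → ℝ)).tilted fun ω => -V ω))
    (_hM24 : ∫ ω, (F₄ ω - (∫ ω', F₄ ω' ∂((volume : Measure (ι → ℝ)).tilted fun ω => -V ω))) ^ 2 ∂((volume : Measure (ι → ℝ)).tilted fun ω => -V ω) ≤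
        M₂) (hM44 : ∫ ω, (F₄ ω - (∫ ω', F₄ ω' ∂((volume : Measure (ι → ℝ)).tilted fun ω => -V ω))) ^ 4 ∂((volume : Measure (ι → ℝ)).tilted fun ω =>
        -V ω) ≤ M₄)
    (hM64 : ∫ ω, (F₄ ω - (∫ ω', F₄ ω' ∂((volume : Measure (ι → ℝ)).tilted fun ω => -V ω))) ^ 6 ∂((volume : Measure (ι → ℝ)).tilted fun ω => -V ω) ≤
        M₆) :
    |(∫ ω, (F₁ ω - (∫ ω', F₁ ω' ∂((volume : Measure (ι → ℝ)).tilted fun ω => -V ω))) * (F₂ ω - (∫ ω', F₂ ω' ∂((volume : Measure (ι → ℝ)).tilted fun ω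
        => -V ω))) * (F₃ ω - (∫ ω', F₃ ω' ∂((volume : Measure (ι → ℝ)).tilted fun ω => -V ω))) * (F₄ ω - (∫ ω', F₄ ω' ∂((volume : Measure (ι →
        ℝ)).tilted fun ω => -V ω))) ∂((volume : Measure (ι → ℝ)).tilted fun ω => -V ω)) - (∫ ω, (F₁ ω - (∫ ω', F₁ ω' ∂((volume : Measure (ι →
        ℝ)).tilted fun ω => -V ω))) * (F₂ ω - (∫ ω', F₂ ω' ∂((volume : Measure (ι → ℝ)).tilted fun ω => -V ω))) ∂((volume : Measure (ι → ℝ)).tilted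
        fun ω => -V ω)) * (∫ ω, (F₃ ω - (∫ ω', F₃ ω' ∂((volume : Measure (ι → ℝ)).tilted fun ω => -V ω))) * (F₄ ω - (∫ ω', F₄ ω' ∂((volume : Measure
        (ι → ℝ)).tilted fun ω => -V ω))) ∂((volume : Measure (ι → ℝ)).tilted fun ω => -V ω)) - (∫ ω, (F₁ ω - (∫ ω', F₁ ω' ∂((volume : Measure (ι →
        ℝ)).tilted fun ω => -V ω))) * (F₃ ω - (∫ ω', F₃ ω' ∂((volume : Measure (ι → ℝ)).tilted fun ω => -V ω))) ∂((volume : Measure (ι → ℝ)).tilted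
        fun ω => -V ω)) * (∫ ω, (F₂ ω - (∫ ω', F₂ ω' ∂((volume : Measure (ι → ℝ)).tilted fun ω => -V ω))) * (F₄ ω - (∫ ω', F₄ ω' ∂((volume : Measure
        (ι → ℝ)).tilted fun ω => -V ω))) ∂((volume : Measure (ι → ℝ)).tilted fun ω => -V ω)) - (∫ ω, (F₁ ω - (∫ ω', F₁ ω' ∂((volume : Measure (ι →
        ℝ)).tilted fun ω => -V ω))) * (F₄ ω - (∫ ω', F₄ ω' ∂((volume : Measure (ι → ℝ)).tilted fun ω => -V ω))) ∂((volume : Measure (ι → ℝ)).tilted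
        fun ω => -V ω)) * (∫ ω, (F₂ ω - (∫ ω', F₂ ω' ∂((volume : Measure (ι → ℝ)).tilted fun ω => -V ω))) * (F₃ ω - (∫ ω', F₃ ω' ∂((volume : Measure
        (ι → ℝ)).tilted fun ω => -V ω))) ∂((volume : Measure (ι → ℝ)).tilted fun ω => -V ω))| ≤
      (4 * K + 3 * K ^ 2 + 4 * M₄ + 4 * M₆ + 2 * M₂ * (M₂ + M₄)) * (max (r13 ^ 2)⁻¹ (max (r23 ^ 2)⁻¹ (r34 ^ 2)⁻¹)) ^ 3 := by
  have hM2 : 0 ≤ M₂ := le_trans (integral_nonneg fun ω => sq_nonneg _) hM21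
  have hM4 : 0 ≤ M₄ := le_trans (integral_nonneg fun ω => by positivity) hM41
  have hM6 : 0 ≤ M₆ := le_trans (integral_nonneg fun ω => by positivity) hM61
  have hC : 0 ≤ (4 * K + 3 * K ^ 2 + 4 * M₄ + 4 * M₆ + 2 * M₂ * (M₂ + M₄)) := by positivity
  have hcS : 3 * K + (4 * M₄ + 4 * M₆) + K ^ 2 + K ^ 2 + K ^ 2 ≤ (4 * K + 3 * K ^ 2 + 4 * M₄ + 4 * M₆ + 2 * M₂ * (M₂ + M₄)) := by nlinarith
  have p12 := pairing_abs_le hP hV hfloor hc hceil hcross hVc hV0 hV2 hJ hJ0 hrow hγ0 hγ1 hD hDC h1 h2 hB12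
  have p13 := pairing_abs_le hP hV hfloor hc hceil hcross hVc hV0 hV2 hJ hJ0 hrow hγ0 hγ1 hD hDC h1 h3 hB13
  have p14 := pairing_abs_le hP hV hfloor hc hceil hcross hVc hV0 hV2 hJ hJ0 hrow hγ0 hγ1 hD hDC h1 h4 hB14
  have p23 := pairing_abs_le hP hV hfloor hc hceil hcross hVc hV0 hV2 hJ hJ0 hrow hγ0 hγ1 hD hDC h2 h3 hB23
  have p24 := pairing_abs_le hP hV hfloor hc hceil hcross hVc hV0 hV2 hJ hJ0 hrow hγ0 hγ1 hD hDC h2 h4 hB24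
  have p34 := pairing_abs_le hP hV hfloor hc hceil hcross hVc hV0 hV2 hJ hJ0 hrow hγ0 hγ1 hD hDC h3 h4 hB34
  have hB31 : (∑ w, (∑ z, D z w * a₃ z) * (∑ z, D z w * a₁ z) / c w) ≤ K / r13 ^ 24 := by rw [bilinear_symm]; exact hB13
  have hB32 : (∑ w, (∑ z, D z w * a₃ z) * (∑ z, D z w * a₂ z) / c w) ≤ K / r23 ^ 24 := by rw [bilinear_symm]; exact hB23
  have eM : ∀ g : (ι → ℝ) → ℝ, (∀ ω, g ω = (F₁ ω - (∫ ω', F₁ ω' ∂((volume : Measure (ι → ℝ)).tilted fun ω => -V ω))) * (F₂ ω - (∫ ω', F₂ ω' ∂((volume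
      : Measure (ι → ℝ)).tilted fun ω => -V ω))) * (F₃ ω - (∫ ω', F₃ ω' ∂((volume : Measure (ι → ℝ)).tilted fun ω => -V ω))) * (F₄ ω - (∫ ω', F₄ ω'
      ∂((volume : Measure (ι → ℝ)).tilted fun ω => -V ω)))) →
      (∫ ω, g ω ∂((volume : Measure (ι → ℝ)).tilted fun ω => -V ω)) = (∫ ω, (F₁ ω - (∫ ω', F₁ ω' ∂((volume : Measure (ι → ℝ)).tilted fun ω => -V ω)))
          * (F₂ ω - (∫ ω', F₂ ω' ∂((volume : Measure (ι → ℝ)).tilted fun ω => -V ω))) * (F₃ ω - (∫ ω', F₃ ω' ∂((volume : Measure (ι → ℝ)).tilted fun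
          ω => -V ω))) * (F₄ ω - (∫ ω', F₄ ω' ∂((volume : Measure (ι → ℝ)).tilted fun ω => -V ω))) ∂((volume : Measure (ι → ℝ)).tilted fun ω => -V
          ω)) := fun g hg =>
    integral_congr_ae (ae_of_all _ hg)
  have hcut := single_cut_bound hP hV hfloor hc hceil hcross hVc hV0 hV2 hJ hJ0 hrow hγ0 hγ1 hD hDC h3 h1 h2 h4 hK hr13 hr23 hr34 hB31 hB32 hB34 hq3
      hs3 hq1 hs1 hq2 hs2 hq4 hs4 hM43 hM63 hM41 hM61 hM42 hM62 hM44 hM64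
  rw [eM _ (fun ω => by ring)] at hcut
  set rmv : ℝ := min r13 (min r23 r34) with hrmv
  have hrm : 1 ≤ rmv := le_min hr13 (le_min hr23 hr34)
  have q1 := pairing_prod_le' hK hrm ((min_le_right _ _).trans (min_le_right _ _)) hr12 p34 p12
  have q2 := pairing_prod_le hK hrm (min_le_left _ _) hr24 p13 p24
  have q3 := pairing_prod_le' hK hrm ((min_le_right _ _).trans (min_le_left _ _)) hr14 p23 p14
  refine (abs_u4_le_single_cut (∫ ω, (F₁ ω - (∫ ω', F₁ ω' ∂((volume : Measure (ι → ℝ)).tilted fun ω => -V ω))) * (F₂ ω - (∫ ω', F₂ ω' ∂((volume :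
      Measure (ι → ℝ)).tilted fun ω => -V ω))) * (F₃ ω - (∫ ω', F₃ ω' ∂((volume : Measure (ι → ℝ)).tilted fun ω => -V ω))) * (F₄ ω - (∫ ω', F₄ ω'
      ∂((volume : Measure (ι → ℝ)).tilted fun ω => -V ω))) ∂((volume : Measure (ι → ℝ)).tilted fun ω => -V ω)) (∫ ω, (F₁ ω - (∫ ω', F₁ ω' ∂((volume :
      Measure (ι → ℝ)).tilted fun ω => -V ω))) * (F₂ ω - (∫ ω', F₂ ω' ∂((volume : Measure (ι → ℝ)).tilted fun ω => -V ω))) ∂((volume : Measure (ι →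
      ℝ)).tilted fun ω => -V ω)) (∫ ω, (F₃ ω - (∫ ω', F₃ ω' ∂((volume : Measure (ι → ℝ)).tilted fun ω => -V ω))) * (F₄ ω - (∫ ω', F₄ ω' ∂((volume :
      Measure (ι → ℝ)).tilted fun ω => -V ω))) ∂((volume : Measure (ι → ℝ)).tilted fun ω => -V ω)) (∫ ω, (F₁ ω - (∫ ω', F₁ ω' ∂((volume : Measure (ι
      → ℝ)).tilted fun ω => -V ω))) * (F₃ ω - (∫ ω', F₃ ω' ∂((volume : Measure (ι → ℝ)).tilted fun ω => -V ω))) ∂((volume : Measure (ι → ℝ)).tilted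
      fun ω => -V ω)) (∫ ω, (F₂ ω - (∫ ω', F₂ ω' ∂((volume : Measure (ι → ℝ)).tilted fun ω => -V ω))) * (F₄ ω - (∫ ω', F₄ ω' ∂((volume : Measure (ι →
      ℝ)).tilted fun ω => -V ω))) ∂((volume : Measure (ι → ℝ)).tilted fun ω => -V ω)) (∫ ω, (F₁ ω - (∫ ω', F₁ ω' ∂((volume : Measure (ι → ℝ)).tilted
      fun ω => -V ω))) * (F₄ ω - (∫ ω', F₄ ω' ∂((volume : Measure (ι → ℝ)).tilted fun ω => -V ω))) ∂((volume : Measure (ι → ℝ)).tilted fun ω => -V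
      ω)) (∫ ω, (F₂ ω - (∫ ω', F₂ ω' ∂((volume : Measure (ι → ℝ)).tilted fun ω => -V ω))) * (F₃ ω - (∫ ω', F₃ ω' ∂((volume : Measure (ι → ℝ)).tilted
      fun ω => -V ω))) ∂((volume : Measure (ι → ℝ)).tilted fun ω => -V ω))).trans ?_
  refine le_trans ?_ (div_pow_six_le hcS hC hrm (inv_min3_sq_le r13 r23 r34))
  have hsum : (3 * K + (4 * M₄ + 4 * M₆)) / rmv ^ 6 + K ^ 2 / rmv ^ 6 + K ^ 2 / rmv ^ 6 + K ^ 2 / rmv ^ 6 =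
      (3 * K + (4 * M₄ + 4 * M₆) + K ^ 2 + K ^ 2 + K ^ 2) / rmv ^ 6 := by ring
  linarith [hcut, q1, q2, q3]
/-- **CUT `{4}|{1,2,3}`**: `|u₄| ≤ C·max(q₁₄,q₂₄,q₃₄)³`. [folklore] -/
theorem cut_four (hP : ∀ x F ω, P x F ω = (∫ s, F (update ω x s) * exp (-V (update ω x s))) / ∫ s, exp (-V (update ω x s)))
    (hV : ∀ x ω, HasDerivAt (fun s => V (update ω x s)) (V₁ x ω) (ω x))
    (hfloor : ∀ x ω s t, c x * (s - t) ^ 2 ≤ (V₁ x (update ω x s) - V₁ x (update ω x t)) * (s - t)) (hc : ∀ x, 0 < c x)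
    (hceil : ∀ x ω s t, |V₁ x (update ω x s) - V₁ x (update ω x t)| ≤ Cw * |s - t|)
    (hcross : ∀ x z, z ≠ x → ∀ ω s t, |V₁ x (update ω z s) - V₁ x (update ω z t)| ≤ J x z * |s - t|) (hVc : Continuous V)
    (hV0 : Integrable (fun ω : ι → ℝ => exp (-V ω))) (hV2 : ∀ z, Integrable (fun ω : ι → ℝ => ω z ^ 2 * exp (-V ω)))
    (hJ : ∀ x z, 0 ≤ J x z) (hJ0 : ∀ x, J x x = 0) (hrow : ∀ x, ∑ z, J x z / c x ≤ γ) (hγ0 : 0 ≤ γ) (hγ1 : γ < 1)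
    (hD : ∀ x y, 0 ≤ D x y) (hDC : ∀ x y, (if x = y then (1 : ℝ) else 0) + ∑ z, D x z * (J z y / c z) ≤ D x y)
    (h1 : ∀ z ω s t, |F₁ (update ω z s) - F₁ (update ω z t)| ≤ a₁ z * |s - t|) (h2 : ∀ z ω s t, |F₂ (update ω z s) - F₂ (update ω z t)| ≤ a₂ z * |s -
        t|)
    (h3 : ∀ z ω s t, |F₃ (update ω z s) - F₃ (update ω z t)| ≤ a₃ z * |s - t|) (h4 : ∀ z ω s t, |F₄ (update ω z s) - F₄ (update ω z t)| ≤ a₄ z * |s -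
        t|)
    {K r12 r13 r14 r23 r24 r34 M₂ M₄ M₆ : ℝ} (hK : 0 ≤ K) (hr12 : 1 ≤ r12) (hr13 : 1 ≤ r13) (hr14 : 1 ≤ r14) (hr23 : 1 ≤ r23) (hr24 : 1 ≤ r24) (hr34
        : 1 ≤ r34)
    (hB12 : (∑ w, (∑ z, D z w * a₁ z) * (∑ z, D z w * a₂ z) / c w) ≤ K / r12 ^ 24)
    (hB13 : (∑ w, (∑ z, D z w * a₁ z) * (∑ z, D z w * a₃ z) / c w) ≤ K / r13 ^ 24)
    (hB14 : (∑ w, (∑ z, D z w * a₁ z) * (∑ z, D z w * a₄ z) / c w) ≤ K / r14 ^ 24)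
    (hB23 : (∑ w, (∑ z, D z w * a₂ z) * (∑ z, D z w * a₃ z) / c w) ≤ K / r23 ^ 24)
    (hB24 : (∑ w, (∑ z, D z w * a₂ z) * (∑ z, D z w * a₄ z) / c w) ≤ K / r24 ^ 24)
    (hB34 : (∑ w, (∑ z, D z w * a₃ z) * (∑ z, D z w * a₄ z) / c w) ≤ K / r34 ^ 24)
    (hq1 : Integrable (fun ω => (F₁ ω - (∫ ω', F₁ ω' ∂((volume : Measure (ι → ℝ)).tilted fun ω => -V ω))) ^ 4) ((volume : Measure (ι → ℝ)).tilted fun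
        ω => -V ω)) (hs1 : Integrable (fun ω => (F₁ ω - (∫ ω', F₁ ω' ∂((volume : Measure (ι → ℝ)).tilted fun ω => -V ω))) ^ 6) ((volume : Measure (ι
        → ℝ)).tilted fun ω => -V ω))
    (hM21 : ∫ ω, (F₁ ω - (∫ ω', F₁ ω' ∂((volume : Measure (ι → ℝ)).tilted fun ω => -V ω))) ^ 2 ∂((volume : Measure (ι → ℝ)).tilted fun ω => -V ω) ≤
        M₂) (hM41 : ∫ ω, (F₁ ω - (∫ ω', F₁ ω' ∂((volume : Measure (ι → ℝ)).tilted fun ω => -V ω))) ^ 4 ∂((volume : Measure (ι → ℝ)).tilted fun ω =>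
        -V ω) ≤ M₄)
    (hM61 : ∫ ω, (F₁ ω - (∫ ω', F₁ ω' ∂((volume : Measure (ι → ℝ)).tilted fun ω => -V ω))) ^ 6 ∂((volume : Measure (ι → ℝ)).tilted fun ω => -V ω) ≤
        M₆)
    (hq2 : Integrable (fun ω => (F₂ ω - (∫ ω', F₂ ω' ∂((volume : Measure (ι → ℝ)).tilted fun ω => -V ω))) ^ 4) ((volume : Measure (ι → ℝ)).tilted fun
        ω => -V ω)) (hs2 : Integrable (fun ω => (F₂ ω - (∫ ω', F₂ ω' ∂((volume : Measure (ι → ℝ)).tilted fun ω => -V ω))) ^ 6) ((volume : Measure (ι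
        → ℝ)).tilted fun ω => -V ω))
    (_hM22 : ∫ ω, (F₂ ω - (∫ ω', F₂ ω' ∂((volume : Measure (ι → ℝ)).tilted fun ω => -V ω))) ^ 2 ∂((volume : Measure (ι → ℝ)).tilted fun ω => -V ω) ≤
        M₂) (hM42 : ∫ ω, (F₂ ω - (∫ ω', F₂ ω' ∂((volume : Measure (ι → ℝ)).tilted fun ω => -V ω))) ^ 4 ∂((volume : Measure (ι → ℝ)).tilted fun ω =>
        -V ω) ≤ M₄)
    (hM62 : ∫ ω, (F₂ ω - (∫ ω', F₂ ω' ∂((volume : Measure (ι → ℝ)).tilted fun ω => -V ω))) ^ 6 ∂((volume : Measure (ι → ℝ)).tilted fun ω => -V ω) ≤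
        M₆)
    (hq3 : Integrable (fun ω => (F₃ ω - (∫ ω', F₃ ω' ∂((volume : Measure (ι → ℝ)).tilted fun ω => -V ω))) ^ 4) ((volume : Measure (ι → ℝ)).tilted fun
        ω => -V ω)) (hs3 : Integrable (fun ω => (F₃ ω - (∫ ω', F₃ ω' ∂((volume : Measure (ι → ℝ)).tilted fun ω => -V ω))) ^ 6) ((volume : Measure (ι
        → ℝ)).tilted fun ω => -V ω))
    (_hM23 : ∫ ω, (F₃ ω - (∫ ω', F₃ ω' ∂((volume : Measure (ι → ℝ)).tilted fun ω => -V ω))) ^ 2 ∂((volume : Measure (ι → ℝ)).tilted fun ω => -V ω) ≤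
        M₂) (hM43 : ∫ ω, (F₃ ω - (∫ ω', F₃ ω' ∂((volume : Measure (ι → ℝ)).tilted fun ω => -V ω))) ^ 4 ∂((volume : Measure (ι → ℝ)).tilted fun ω =>
        -V ω) ≤ M₄)
    (hM63 : ∫ ω, (F₃ ω - (∫ ω', F₃ ω' ∂((volume : Measure (ι → ℝ)).tilted fun ω => -V ω))) ^ 6 ∂((volume : Measure (ι → ℝ)).tilted fun ω => -V ω) ≤
        M₆)
    (hq4 : Integrable (fun ω => (F₄ ω - (∫ ω', F₄ ω' ∂((volume : Measure (ι → ℝ)).tilted fun ω => -V ω))) ^ 4) ((volume : Measure (ι → ℝ)).tilted fun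
        ω => -V ω)) (hs4 : Integrable (fun ω => (F₄ ω - (∫ ω', F₄ ω' ∂((volume : Measure (ι → ℝ)).tilted fun ω => -V ω))) ^ 6) ((volume : Measure (ι
        → ℝ)).tilted fun ω => -V ω))
    (_hM24 : ∫ ω, (F₄ ω - (∫ ω', F₄ ω' ∂((volume : Measure (ι → ℝ)).tilted fun ω => -V ω))) ^ 2 ∂((volume : Measure (ι → ℝ)).tilted fun ω => -V ω) ≤
        M₂) (hM44 : ∫ ω, (F₄ ω - (∫ ω', F₄ ω' ∂((volume : Measure (ι → ℝ)).tilted fun ω => -V ω))) ^ 4 ∂((volume : Measure (ι → ℝ)).tilted fun ω =>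
        -V ω) ≤ M₄)
    (hM64 : ∫ ω, (F₄ ω - (∫ ω', F₄ ω' ∂((volume : Measure (ι → ℝ)).tilted fun ω => -V ω))) ^ 6 ∂((volume : Measure (ι → ℝ)).tilted fun ω => -V ω) ≤
        M₆) :
    |(∫ ω, (F₁ ω - (∫ ω', F₁ ω' ∂((volume : Measure (ι → ℝ)).tilted fun ω => -V ω))) * (F₂ ω - (∫ ω', F₂ ω' ∂((volume : Measure (ι → ℝ)).tilted fun ω
        => -V ω))) * (F₃ ω - (∫ ω', F₃ ω' ∂((volume : Measure (ι → ℝ)).tilted fun ω => -V ω))) * (F₄ ω - (∫ ω', F₄ ω' ∂((volume : Measure (ι →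
        ℝ)).tilted fun ω => -V ω))) ∂((volume : Measure (ι → ℝ)).tilted fun ω => -V ω)) - (∫ ω, (F₁ ω - (∫ ω', F₁ ω' ∂((volume : Measure (ι →
        ℝ)).tilted fun ω => -V ω))) * (F₂ ω - (∫ ω', F₂ ω' ∂((volume : Measure (ι → ℝ)).tilted fun ω => -V ω))) ∂((volume : Measure (ι → ℝ)).tilted
        fun ω => -V ω)) * (∫ ω, (F₃ ω - (∫ ω', F₃ ω' ∂((volume : Measure (ι → ℝ)).tilted fun ω => -V ω))) * (F₄ ω - (∫ ω', F₄ ω' ∂((volume : Measure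
        (ι → ℝ)).tilted fun ω => -V ω))) ∂((volume : Measure (ι → ℝ)).tilted fun ω => -V ω)) - (∫ ω, (F₁ ω - (∫ ω', F₁ ω' ∂((volume : Measure (ι →
        ℝ)).tilted fun ω => -V ω))) * (F₃ ω - (∫ ω', F₃ ω' ∂((volume : Measure (ι → ℝ)).tilted fun ω => -V ω))) ∂((volume : Measure (ι → ℝ)).tilted
        fun ω => -V ω)) * (∫ ω, (F₂ ω - (∫ ω', F₂ ω' ∂((volume : Measure (ι → ℝ)).tilted fun ω => -V ω))) * (F₄ ω - (∫ ω', F₄ ω' ∂((volume : Measure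
        (ι → ℝ)).tilted fun ω => -V ω))) ∂((volume : Measure (ι → ℝ)).tilted fun ω => -V ω)) - (∫ ω, (F₁ ω - (∫ ω', F₁ ω' ∂((volume : Measure (ι →
        ℝ)).tilted fun ω => -V ω))) * (F₄ ω - (∫ ω', F₄ ω' ∂((volume : Measure (ι → ℝ)).tilted fun ω => -V ω))) ∂((volume : Measure (ι → ℝ)).tilted
        fun ω => -V ω)) * (∫ ω, (F₂ ω - (∫ ω', F₂ ω' ∂((volume : Measure (ι → ℝ)).tilted fun ω => -V ω))) * (F₃ ω - (∫ ω', F₃ ω' ∂((volume : Measure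
        (ι → ℝ)).tilted fun ω => -V ω))) ∂((volume : Measure (ι → ℝ)).tilted fun ω => -V ω))| ≤
      (4 * K + 3 * K ^ 2 + 4 * M₄ + 4 * M₆ + 2 * M₂ * (M₂ + M₄)) * (max (r14 ^ 2)⁻¹ (max (r24 ^ 2)⁻¹ (r34 ^ 2)⁻¹)) ^ 3 := by
  have hM2 : 0 ≤ M₂ := le_trans (integral_nonneg fun ω => sq_nonneg _) hM21
  have hM4 : 0 ≤ M₄ := le_trans (integral_nonneg fun ω => by positivity) hM41
  have hM6 : 0 ≤ M₆ := le_trans (integral_nonneg fun ω => by positivity) hM61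
  have hC : 0 ≤ (4 * K + 3 * K ^ 2 + 4 * M₄ + 4 * M₆ + 2 * M₂ * (M₂ + M₄)) := by positivity
  have hcS : 3 * K + (4 * M₄ + 4 * M₆) + K ^ 2 + K ^ 2 + K ^ 2 ≤ (4 * K + 3 * K ^ 2 + 4 * M₄ + 4 * M₆ + 2 * M₂ * (M₂ + M₄)) := by nlinarith
  have p12 := pairing_abs_le hP hV hfloor hc hceil hcross hVc hV0 hV2 hJ hJ0 hrow hγ0 hγ1 hD hDC h1 h2 hB12
  have p13 := pairing_abs_le hP hV hfloor hc hceil hcross hVc hV0 hV2 hJ hJ0 hrow hγ0 hγ1 hD hDC h1 h3 hB13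
  have p14 := pairing_abs_le hP hV hfloor hc hceil hcross hVc hV0 hV2 hJ hJ0 hrow hγ0 hγ1 hD hDC h1 h4 hB14
  have p23 := pairing_abs_le hP hV hfloor hc hceil hcross hVc hV0 hV2 hJ hJ0 hrow hγ0 hγ1 hD hDC h2 h3 hB23
  have p24 := pairing_abs_le hP hV hfloor hc hceil hcross hVc hV0 hV2 hJ hJ0 hrow hγ0 hγ1 hD hDC h2 h4 hB24
  have p34 := pairing_abs_le hP hV hfloor hc hceil hcross hVc hV0 hV2 hJ hJ0 hrow hγ0 hγ1 hD hDC h3 h4 hB34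
  have hB41 : (∑ w, (∑ z, D z w * a₄ z) * (∑ z, D z w * a₁ z) / c w) ≤ K / r14 ^ 24 := by rw [bilinear_symm]; exact hB14
  have hB42 : (∑ w, (∑ z, D z w * a₄ z) * (∑ z, D z w * a₂ z) / c w) ≤ K / r24 ^ 24 := by rw [bilinear_symm]; exact hB24
  have hB43 : (∑ w, (∑ z, D z w * a₄ z) * (∑ z, D z w * a₃ z) / c w) ≤ K / r34 ^ 24 := by rw [bilinear_symm]; exact hB34
  have eM : ∀ g : (ι → ℝ) → ℝ, (∀ ω, g ω = (F₁ ω - (∫ ω', F₁ ω' ∂((volume : Measure (ι → ℝ)).tilted fun ω => -V ω))) * (F₂ ω - (∫ ω', F₂ ω' ∂((volume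
      : Measure (ι → ℝ)).tilted fun ω => -V ω))) * (F₃ ω - (∫ ω', F₃ ω' ∂((volume : Measure (ι → ℝ)).tilted fun ω => -V ω))) * (F₄ ω - (∫ ω', F₄ ω'
      ∂((volume : Measure (ι → ℝ)).tilted fun ω => -V ω)))) →
      (∫ ω, g ω ∂((volume : Measure (ι → ℝ)).tilted fun ω => -V ω)) = (∫ ω, (F₁ ω - (∫ ω', F₁ ω' ∂((volume : Measure (ι → ℝ)).tilted fun ω => -V ω)))
          * (F₂ ω - (∫ ω', F₂ ω' ∂((volume : Measure (ι → ℝ)).tilted fun ω => -V ω))) * (F₃ ω - (∫ ω', F₃ ω' ∂((volume : Measure (ι → ℝ)).tilted fun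
          ω => -V ω))) * (F₄ ω - (∫ ω', F₄ ω' ∂((volume : Measure (ι → ℝ)).tilted fun ω => -V ω))) ∂((volume : Measure (ι → ℝ)).tilted fun ω => -V
          ω)) := fun g hg =>
    integral_congr_ae (ae_of_all _ hg)
  have hcut := single_cut_bound hP hV hfloor hc hceil hcross hVc hV0 hV2 hJ hJ0 hrow hγ0 hγ1 hD hDC h4 h1 h2 h3 hK hr14 hr24 hr34 hB41 hB42 hB43 hq4
      hs4 hq1 hs1 hq2 hs2 hq3 hs3 hM44 hM64 hM41 hM61 hM42 hM62 hM43 hM63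
  rw [eM _ (fun ω => by ring)] at hcut
  set rmv : ℝ := min r14 (min r24 r34) with hrmv
  have hrm : 1 ≤ rmv := le_min hr14 (le_min hr24 hr34)
  have q1 := pairing_prod_le' hK hrm ((min_le_right _ _).trans (min_le_right _ _)) hr12 p34 p12
  have q2 := pairing_prod_le' hK hrm ((min_le_right _ _).trans (min_le_left _ _)) hr13 p24 p13
  have q3 := pairing_prod_le hK hrm (min_le_left _ _) hr23 p14 p23
  refine (abs_u4_le_single_cut (∫ ω, (F₁ ω - (∫ ω', F₁ ω' ∂((volume : Measure (ι → ℝ)).tilted fun ω => -V ω))) * (F₂ ω - (∫ ω', F₂ ω' ∂((volume :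
      Measure (ι → ℝ)).tilted fun ω => -V ω))) * (F₃ ω - (∫ ω', F₃ ω' ∂((volume : Measure (ι → ℝ)).tilted fun ω => -V ω))) * (F₄ ω - (∫ ω', F₄ ω'
      ∂((volume : Measure (ι → ℝ)).tilted fun ω => -V ω))) ∂((volume : Measure (ι → ℝ)).tilted fun ω => -V ω)) (∫ ω, (F₁ ω - (∫ ω', F₁ ω' ∂((volume :
      Measure (ι → ℝ)).tilted fun ω => -V ω))) * (F₂ ω - (∫ ω', F₂ ω' ∂((volume : Measure (ι → ℝ)).tilted fun ω => -V ω))) ∂((volume : Measure (ι →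
      ℝ)).tilted fun ω => -V ω)) (∫ ω, (F₃ ω - (∫ ω', F₃ ω' ∂((volume : Measure (ι → ℝ)).tilted fun ω => -V ω))) * (F₄ ω - (∫ ω', F₄ ω' ∂((volume :
      Measure (ι → ℝ)).tilted fun ω => -V ω))) ∂((volume : Measure (ι → ℝ)).tilted fun ω => -V ω)) (∫ ω, (F₁ ω - (∫ ω', F₁ ω' ∂((volume : Measure (ι
      → ℝ)).tilted fun ω => -V ω))) * (F₃ ω - (∫ ω', F₃ ω' ∂((volume : Measure (ι → ℝ)).tilted fun ω => -V ω))) ∂((volume : Measure (ι → ℝ)).tilted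
      fun ω => -V ω)) (∫ ω, (F₂ ω - (∫ ω', F₂ ω' ∂((volume : Measure (ι → ℝ)).tilted fun ω => -V ω))) * (F₄ ω - (∫ ω', F₄ ω' ∂((volume : Measure (ι →
      ℝ)).tilted fun ω => -V ω))) ∂((volume : Measure (ι → ℝ)).tilted fun ω => -V ω)) (∫ ω, (F₁ ω - (∫ ω', F₁ ω' ∂((volume : Measure (ι → ℝ)).tilted
      fun ω => -V ω))) * (F₄ ω - (∫ ω', F₄ ω' ∂((volume : Measure (ι → ℝ)).tilted fun ω => -V ω))) ∂((volume : Measure (ι → ℝ)).tilted fun ω => -V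
      ω)) (∫ ω, (F₂ ω - (∫ ω', F₂ ω' ∂((volume : Measure (ι → ℝ)).tilted fun ω => -V ω))) * (F₃ ω - (∫ ω', F₃ ω' ∂((volume : Measure (ι → ℝ)).tilted
      fun ω => -V ω))) ∂((volume : Measure (ι → ℝ)).tilted fun ω => -V ω))).trans ?_
  refine le_trans ?_ (div_pow_six_le hcS hC hrm (inv_min3_sq_le r14 r24 r34))
  have hsum : (3 * K + (4 * M₄ + 4 * M₆)) / rmv ^ 6 + K ^ 2 / rmv ^ 6 + K ^ 2 / rmv ^ 6 + K ^ 2 / rmv ^ 6 =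
      (3 * K + (4 * M₄ + 4 * M₆) + K ^ 2 + K ^ 2 + K ^ 2) / rmv ^ 6 := by ring
  linarith [hcut, q1, q2, q3]
end Summit.QuantumFields.BalabanUV.T4Continuum.NE7b.SupFourthCumulantSingleCutsTwo

end
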